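import Literature.AlgebraicGeometry.Morphisms.RigidityLemmaStein
import Literature.AlgebraicGeometry.Morphisms.RigidityLemma
import HarnessLib

/-!
# The rigidity lemma when EVERY fibre is contracted — no connectedness of the base

Layer `Literature/AlgebraicGeometry/Morphisms`, namespace `Literature.AlgebraicGeometry.Morphisms`.  Cell `hodgecm-mathlib`
(D-0151), F-DAG leaf F-1 (b′) (author B-p02 (g12)); count-neutral capital, PROOF lane, theorems only (no definition, no
named fact, no instance, no `sorry`).  HC_CM is proved only modulo the 7 printed citations until rung 0 closes; this file
asserts nothing about HC.

The tree's Stein form of the rigidity lemma ★ `Morphisms.rigidity_of_surjective` / ★ `rigidity_of_stein`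
([MumfordFogartyKirwan1994] Ch. 6 §1 Prop. 6.1, [MumfordAV1970] §4) — `p : X → S` universally closed and universally open
with a section `ε`, Stein (`Γ(W, 𝒪_S) ↠ Γ(p⁻¹W, 𝒪_X)` for every open `W`), `S` PRECONNECTED, `f : X → Y` an `S`-morphism to
a separated `Y/S` contracting the fibre over ONE point ⇒ `f = p ≫ ε ≫ f` — uses the connectedness of `S` (and the
openness of `p`, the separatedness of `Y → S`) ONLY to spread the contraction of one fibre to all fibres, through the
open-and-closed set `T` of base points with contracted fibre.  When EVERY fibre is already contracted (the situation of
[MumfordFogartyKirwan1994] Cor. 6.4 / 6.5, where the quotient of the two morphisms to be compared is POINTWISE the unit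
section), none of this is needed: Mumford's tube argument (★ `comp_eq_comp_of_forall_mem_affineOpen_of_surjective`: over the
open set `W_s = {u | p⁻¹(u) ⊆ f⁻¹(V)}` of ★ `isOpen_setOf_fiber_subset`, `V ∋ f(p⁻¹ s)` affine, `f` agrees with `f ∘ ε ∘ p`)
produces agreeing tubes around every fibre, and the tubes cover `X`.

* `eq_comp_of_forall_fibre_const_of_surjective` — `p` universally closed with a section `ε`, `Γ(W, 𝒪_S) ↠ Γ(p⁻¹W, 𝒪_X)`
  for all `W`, every fibre of `p` contracted by `f : X → Y` (ANY morphism, any `Y`) ⇒ `f = p ≫ ε ≫ f`; NO connectedness,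
  NO separatedness, NO universal openness;
* `eq_comp_of_forall_fibre_const_of_stein` — the same with the Stein hypothesis as `Γ(W, 𝒪_S) ⥲ Γ(p⁻¹W, 𝒪_X)`
  (★ `surjective_morphismRestrict_appTop_of_bijective_app`);
* `eq_comp_of_forall_apply_eq_of_stein` — the same with the contraction hypothesis as
  `p x = p x' → f x = f x'`.

## References
* [MumfordFogartyKirwan1994] D. Mumford, J. Fogarty, F. Kirwan, *Geometric Invariant Theory*, 3rd ed. (1994), Ch. 6 §1
  Proposition 6.1 (Rigidity lemma) (pp. 115–116) and its proof; Corollary 6.4 / 6.5 (p. 117).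
* [MumfordAV1970] D. Mumford, *Abelian Varieties* (1970), §4, Rigidity lemma (p. 43) and its proof.
-/

noncomputable section

universe u

open CategoryTheory CategoryTheory.Limits AlgebraicGeometry TopologicalSpace

namespace Literature.AlgebraicGeometry.Morphisms

variable {X Y S : Scheme.{u}}

/-- **RIGIDITY WITH EVERY FIBRE CONTRACTED — no connectedness.**  Let `p : X → S` be universally closed with a section
`ε : S → X`, such that every function on every tube comes from the base (`hStein : Γ(W, 𝒪_S) → Γ(p⁻¹W, 𝒪_X)` onto for all
open `W`, as the global sections of `p|_W`), and let `f : X → Y` be ANY morphism mapping each fibre `p⁻¹(s)` to a single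
point.  Then `f = (f ∘ ε) ∘ p`.  Proof: for each `s` pick an affine open `V ∋ f(p⁻¹ s)`; over the open
`W_s = {u | p⁻¹(u) ⊆ f⁻¹(V)} ∋ s` (★ `isOpen_setOf_fiber_subset`, `p` closed) the two morphisms agree on the tube `p⁻¹W_s`
(★ `comp_eq_comp_of_forall_mem_affineOpen_of_surjective`); the tubes cover `X`.
[cite: MumfordFogartyKirwan1994, Ch. 6 §1 Proposition 6.1 (Rigidity lemma) (pp. 115–116)] [cite: MumfordAV1970, §4 Rigidity lemma (p. 43)] -/
theorem eq_comp_of_forall_fibre_const_of_surjective {p : X ⟶ S} [UniversallyClosed p] (f : X ⟶ Y) (ε : S ⟶ X)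
    (hε : ε ≫ p = 𝟙 S) (hStein : ∀ W : S.Opens, Function.Surjective (p ∣_ W).appTop.hom)
    (h : ∀ s : S, ∃ y : Y, ∀ x : X, p.base x = s → f.base x = y) :
    f = p ≫ ε ≫ f := by
  -- every fibre has a TUBE on which `f = p ≫ ε ≫ f`
  have hK : ∀ s : S, ∃ W : S.Opens, s ∈ W ∧ (p ⁻¹ᵁ W).ι ≫ f = (p ⁻¹ᵁ W).ι ≫ p ≫ ε ≫ f := by
    intro s
    obtain ⟨y, hy⟩ := h s
    obtain ⟨V, hV, hyV, -⟩ := exists_isAffineOpen_mem_and_subset (X := Y) (x := y) (U := ⊤) trivial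
    let W : S.Opens := ⟨{u : S | ∀ x : X, p.base x = u → x ∈ f ⁻¹ᵁ V},
      isOpen_setOf_fiber_subset p p.isClosedMap (f ⁻¹ᵁ V)⟩
    refine ⟨W, fun x hx => ?_, comp_eq_comp_of_forall_mem_affineOpen_of_surjective f ε hε W (hStein W) hV ?_⟩
    · show f.base x ∈ V
      rw [hy x hx]
      exact hyV
    · intro x hx
      exact hx x rfl
  -- the tubes cover `X`
  choose W hsW hW using hK
  have hcov : IsOpenCover fun s : S => p ⁻¹ᵁ W s := by
    rw [IsOpenCover, eq_top_iff]
    intro x _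
    rw [Opens.mem_iSup]
    exact ⟨p.base x, hsW (p.base x)⟩
  exact Scheme.Cover.hom_ext (X.openCoverOfIsOpenCover (fun s : S => p ⁻¹ᵁ W s) hcov) _ _ fun s => hW s

/-- **Rigidity with every fibre contracted, STEIN HYPOTHESIS in `Scheme.Hom.app` currency** (`Γ(W, 𝒪_S) ⥲ Γ(p⁻¹W, 𝒪_X)` for
every open `W`, e.g. ★ `AbelianSchemeOver.app_bijective_of_isLocallyNoetherian`): `p` universally closed with a section,
`f` contracting every fibre ⇒ `f = p ≫ ε ≫ f`.  No connectedness, no separatedness, no openness.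
[cite: MumfordFogartyKirwan1994, Ch. 6 §1 Proposition 6.1 (Rigidity lemma) (pp. 115–116)] [cite: MumfordAV1970, §4 Rigidity lemma (p. 43)] -/
theorem eq_comp_of_forall_fibre_const_of_stein {p : X ⟶ S} [UniversallyClosed p] (f : X ⟶ Y) (ε : S ⟶ X)
    (hε : ε ≫ p = 𝟙 S) (hStein : ∀ W : S.Opens, Function.Bijective (p.app W).hom)
    (h : ∀ s : S, ∃ y : Y, ∀ x : X, p.base x = s → f.base x = y) :
    f = p ≫ ε ≫ f :=
  eq_comp_of_forall_fibre_const_of_surjective f ε hε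
    (fun W => surjective_morphismRestrict_appTop_of_bijective_app p W (hStein _)) h

/-- **Rigidity with every fibre contracted, pointwise form**: `p x = p x' → f x = f x'` for all `x, x'` ⇒ `f = p ≫ ε ≫ f`
(`p` universally closed, Stein, with a section `ε`).  No connectedness.
[cite: MumfordFogartyKirwan1994, Ch. 6 §1 Proposition 6.1 (Rigidity lemma) (pp. 115–116)] [cite: MumfordAV1970, §4 Rigidity lemma (p. 43)] -/
theorem eq_comp_of_forall_apply_eq_of_stein {p : X ⟶ S} [UniversallyClosed p] (f : X ⟶ Y) (ε : S ⟶ X)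
    (hε : ε ≫ p = 𝟙 S) (hStein : ∀ W : S.Opens, Function.Bijective (p.app W).hom)
    (h : ∀ x x' : X, p.base x = p.base x' → f.base x = f.base x') :
    f = p ≫ ε ≫ f :=
  eq_comp_of_forall_fibre_const_of_stein f ε hε hStein fun s =>
    ⟨f.base (ε.base s), fun x hx => h x (ε.base s) (by rw [hx, ← Scheme.Hom.comp_apply, hε]; rfl)⟩

end Literature.AlgebraicGeometry.Morphisms

end
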